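import Summits.CriticalPhenomena.PercolationContinuityZ3.Theorems.PercNearOneGluingNoHeavyQuantFarGate3Count
import Summits.CriticalPhenomena.PercolationContinuityZ3.Theorems.PercNearOneGluingNoHeavyQuantFarGate3Coins
import HarnessLib

/-!
# QUANT lane R8, front "FAR beyond trees", layer one — THE DEGREE-THREE GATE AT THE OBSERVER, VIII: the law of `N ≤ 1` with the outside count

builds on p205010 (kernel theorem, internal audit signed; external expert review pending)

Support file (`--supports stmt-CriticalPhenomena-4575`), seat `prim-quant-p1` (gen 28); memo
`run/shared/lean/prim/quant/prim-quant-p1-g28/FOR-LEAD-GATE3.md` §5, §7.  Standard axioms; no sorries; no definitions.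

Refines `Gate3.real_card_le_one_le` (file III) by the number `K = #{b ∈ B : o ~ b off v}` of outside relays (`B = A ∖ {v,u₁,u₂}`) reached
off `v`: by the count identity of file VII, on a good configuration in coin state `(c_p, c₁, c₂)` the event `N ≤ 1` forces
`(1,0,0): ¬G₁∧¬G₂∧K=0`; `(0,1,1): ¬G₁∧¬G₂∧K≤1`; `(0,1,0): ¬G₁∧(G₂→K=0)∧K≤1`; `(0,0,1)`: mirror; `(0,0,0): ¬(G₁∧G₂)∧(G₁→K=0)∧(G₂→K=0)∧K≤1`;
and is impossible in the states `(1,1,·)`, `(1,0,1)`.  Integrating over the eight states (file II):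
**`Gate3.real_card_le_one_le_K`** — `P(N ≤ 1) ≤ p(1−r₁)(1−r₂)·P(¬G₁∧¬G₂∧K=0) + (1−p)r₁r₂·P(¬G₁∧¬G₂∧K≤1) + (1−p)r₁(1−r₂)·P(¬G₁∧(G₂→K=0)∧K≤1)
+ (1−p)(1−r₁)r₂·P(¬G₂∧(G₁→K=0)∧K≤1) + (1−p)(1−r₁)(1−r₂)·P(¬(G₁∧G₂)∧(G₁→K=0)∧(G₂→K=0)∧K≤1)` — the `φ`-column of the reduced LP (memo §1).
[cite: Grimmett1999, §1.3 p. 10; §2.2]; the bookkeeping is [this work].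
-/

noncomputable section

namespace Summit.CriticalPhenomena.PercolationContinuityZ3.Theorems

namespace Quant

namespace Gate3

open Finset MeasureTheory Set
open Literature.Probability.LatticeModels
open Literature.Probability.Percolation
open Bundle (offZ reachable_of_offZ)
open scoped Classical

variable {n : ℕ} {o v u₁ u₂ : Fin n}

section Law

variable (w : Sym2 (Fin n) → unitInterval)
  (hw : ∀ z : Fin n, z ≠ o → z ≠ u₁ → z ≠ u₂ → z ≠ v → (w s(v, z) : ℝ) = 0)
  (hov : o ≠ v) (h1v : u₁ ≠ v) (h2v : u₂ ≠ v) (ho1 : o ≠ u₁) (ho2 : o ≠ u₂) (h12 : u₁ ≠ u₂)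
include hw hov h1v h2v ho1 ho2 h12

/-- **Upper bound for `P(N ≤ 1)` with the outside count `K`** (eight coin states; `B = A ∖ {v,u₁,u₂}`). [this work] -/
theorem real_card_le_one_le_K (A : Finset (Fin n)) (hvA : v ∈ A) (h1A : u₁ ∈ A) (h2A : u₂ ∈ A) :
    (prodBernoulli w).real {ω : BondConfig (Fin n) | (A.filter fun a => ω ∈ openConn o a).card ≤ 1} ≤
      (w s(o, v) : ℝ) * ((1 - w s(v, u₁)) * (1 - w s(v, u₂))) *
          (prodBernoulli w).real {ω : BondConfig (Fin n) |
            ¬ (openGraph (offZ {v} ω)).Reachable o u₁ ∧ ¬ (openGraph (offZ {v} ω)).Reachable o u₂ ∧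
            ((((A.erase v).erase u₁).erase u₂).filter fun b => offZ {v} ω ∈ openConn o b).card = 0} +
        (1 - (w s(o, v) : ℝ)) * (w s(v, u₁) * w s(v, u₂)) *
          (prodBernoulli w).real {ω : BondConfig (Fin n) |
            ¬ (openGraph (offZ {v} ω)).Reachable o u₁ ∧ ¬ (openGraph (offZ {v} ω)).Reachable o u₂ ∧
            ((((A.erase v).erase u₁).erase u₂).filter fun b => offZ {v} ω ∈ openConn o b).card ≤ 1} +
        (1 - (w s(o, v) : ℝ)) * (w s(v, u₁) * (1 - w s(v, u₂))) *
          (prodBernoulli w).real {ω : BondConfig (Fin n) |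
            ¬ (openGraph (offZ {v} ω)).Reachable o u₁ ∧
            ((openGraph (offZ {v} ω)).Reachable o u₂ →
              ((((A.erase v).erase u₁).erase u₂).filter fun b => offZ {v} ω ∈ openConn o b).card = 0) ∧
            ((((A.erase v).erase u₁).erase u₂).filter fun b => offZ {v} ω ∈ openConn o b).card ≤ 1} +
        (1 - (w s(o, v) : ℝ)) * ((1 - w s(v, u₁)) * w s(v, u₂)) *
          (prodBernoulli w).real {ω : BondConfig (Fin n) |
            ¬ (openGraph (offZ {v} ω)).Reachable o u₂ ∧
            ((openGraph (offZ {v} ω)).Reachable o u₁ →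
              ((((A.erase v).erase u₁).erase u₂).filter fun b => offZ {v} ω ∈ openConn o b).card = 0) ∧
            ((((A.erase v).erase u₁).erase u₂).filter fun b => offZ {v} ω ∈ openConn o b).card ≤ 1} +
        (1 - (w s(o, v) : ℝ)) * ((1 - w s(v, u₁)) * (1 - w s(v, u₂))) *
          (prodBernoulli w).real {ω : BondConfig (Fin n) |
            ¬ ((openGraph (offZ {v} ω)).Reachable o u₁ ∧ (openGraph (offZ {v} ω)).Reachable o u₂) ∧
            ((openGraph (offZ {v} ω)).Reachable o u₁ →
              ((((A.erase v).erase u₁).erase u₂).filter fun b => offZ {v} ω ∈ openConn o b).card = 0) ∧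
            ((openGraph (offZ {v} ω)).Reachable o u₂ →
              ((((A.erase v).erase u₁).erase u₂).filter fun b => offZ {v} ω ∈ openConn o b).card = 0) ∧
            ((((A.erase v).erase u₁).erase u₂).filter fun b => offZ {v} ω ∈ openConn o b).card ≤ 1} := by
  -- pointwise: in each state, `N ≤ 1` forces an off-`v` event (via the count identity of file VII)
  have step : ∀ (P : Prop → Prop → Prop → Prop) (Q : BondConfig (Fin n) → Prop),
      (∀ ω, (∀ z : Fin n, z ≠ o → z ≠ u₁ → z ≠ u₂ → z ≠ v → s(v, z) ∉ ω) →
        P (s(o, v) ∈ ω) (s(v, u₁) ∈ ω) (s(v, u₂) ∈ ω) →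
        (A.filter fun a => ω ∈ openConn o a).card ≤ 1 → Q (offZ {v} ω)) →
      (prodBernoulli w).real ({ω : BondConfig (Fin n) | (A.filter fun a => ω ∈ openConn o a).card ≤ 1} ∩
          {ω : BondConfig (Fin n) | P (s(o, v) ∈ ω) (s(v, u₁) ∈ ω) (s(v, u₂) ∈ ω)}) ≤
        (prodBernoulli w).real {ω : BondConfig (Fin n) | P (s(o, v) ∈ ω) (s(v, u₁) ∈ ω) (s(v, u₂) ∈ ω)} *
          (prodBernoulli w).real {ω | Q (offZ {v} ω)} := by
    intro P Q hPQ
    exact real_inter_state_le w hw _ P Q fun ω hω hP hx => hPQ ω hω hP hx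
  -- the count identity and the reach lemmas, per good configuration
  have CNT : ∀ ω : BondConfig (Fin n), (∀ z : Fin n, z ≠ o → z ≠ u₁ → z ≠ u₂ → z ≠ v → s(v, z) ∉ ω) →
      (A.filter fun a => ω ∈ openConn o a).card =
        (if ω ∈ openConn o v then 1 else 0) + (if ω ∈ openConn o u₁ then 1 else 0) + (if ω ∈ openConn o u₂ then 1 else 0) +
        (((((A.erase v).erase u₁).erase u₂).filter fun b => offZ {v} ω ∈ openConn o b).card +
          (if s(o, v) ∈ ω ∨ (s(v, u₁) ∈ ω ∧ (openGraph (offZ {v} ω)).Reachable o u₁) ∨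
              (s(v, u₂) ∈ ω ∧ (openGraph (offZ {v} ω)).Reachable o u₂) then
            ((((A.erase v).erase u₁).erase u₂).filter fun b => ¬ (openGraph (offZ {v} ω)).Reachable o b ∧
              ((s(v, u₁) ∈ ω ∧ (openGraph (offZ {v} ω)).Reachable u₁ b) ∨
                (s(v, u₂) ∈ ω ∧ (openGraph (offZ {v} ω)).Reachable u₂ b))).card
          else 0)) := fun ω hω => card_eq hω hov h1v h2v hvA h1A h2A h12
  have RV : ∀ ω : BondConfig (Fin n), (∀ z : Fin n, z ≠ o → z ≠ u₁ → z ≠ u₂ → z ≠ v → s(v, z) ∉ ω) →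
      ((openGraph ω).Reachable o v ↔ s(o, v) ∈ ω ∨ (s(v, u₁) ∈ ω ∧ (openGraph (offZ {v} ω)).Reachable o u₁) ∨
        (s(v, u₂) ∈ ω ∧ (openGraph (offZ {v} ω)).Reachable o u₂)) := fun ω hω => reach_v_iff hω hov h1v h2v
  have RU1 : ∀ ω : BondConfig (Fin n), (openGraph (offZ {v} ω)).Reachable o u₁ → ω ∈ openConn o u₁ :=
    fun ω h => reachable_of_offZ h
  have RU2 : ∀ ω : BondConfig (Fin n), (openGraph (offZ {v} ω)).Reachable o u₂ → ω ∈ openConn o u₂ :=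
    fun ω h => reachable_of_offZ h
  have RU1' : ∀ ω : BondConfig (Fin n), (openGraph ω).Reachable o v → s(v, u₁) ∈ ω → ω ∈ openConn o u₁ := by
    intro ω hv h1
    have e : (openGraph ω).Adj v u₁ := by rw [openGraph_adj]; exact ⟨h1, h1v.symm⟩
    exact hv.trans e.reachable
  have RU2' : ∀ ω : BondConfig (Fin n), (openGraph ω).Reachable o v → s(v, u₂) ∈ ω → ω ∈ openConn o u₂ := by
    intro ω hv h2
    have e : (openGraph ω).Adj v u₂ := by rw [openGraph_adj]; exact ⟨h2, h2v.symm⟩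
    exact hv.trans e.reachable
  -- a generic consequence of the count identity: the three gate indicators and `K` are at most `N`
  have BND : ∀ ω : BondConfig (Fin n), (∀ z : Fin n, z ≠ o → z ≠ u₁ → z ≠ u₂ → z ≠ v → s(v, z) ∉ ω) →
      (if ω ∈ openConn o v then 1 else 0) + (if ω ∈ openConn o u₁ then 1 else 0) + (if ω ∈ openConn o u₂ then 1 else 0) +
        ((((A.erase v).erase u₁).erase u₂).filter fun b => offZ {v} ω ∈ openConn o b).card ≤
        (A.filter fun a => ω ∈ openConn o a).card := by
    intro ω hω
    rw [CNT ω hω]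
    omega
  -- the eight states
  have b1 := step (fun a b c => a ∧ b ∧ c) (fun _ => False) (by
    rintro ω hω ⟨hp, h1, -⟩ hN
    have hv : ω ∈ openConn o v := (RV ω hω).2 (Or.inl hp)
    have hu : ω ∈ openConn o u₁ := RU1' ω hv h1
    have := BND ω hω
    rw [if_pos hv, if_pos hu] at this
    omega)
  have b2 := step (fun a b c => a ∧ b ∧ ¬ c) (fun _ => False) (by
    rintro ω hω ⟨hp, h1, -⟩ hN
    have hv : ω ∈ openConn o v := (RV ω hω).2 (Or.inl hp)
    have hu : ω ∈ openConn o u₁ := RU1' ω hv h1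
    have := BND ω hω
    rw [if_pos hv, if_pos hu] at this
    omega)
  have b3 := step (fun a b c => a ∧ ¬ b ∧ c) (fun _ => False) (by
    rintro ω hω ⟨hp, -, h2⟩ hN
    have hv : ω ∈ openConn o v := (RV ω hω).2 (Or.inl hp)
    have hu : ω ∈ openConn o u₂ := RU2' ω hv h2
    have := BND ω hω
    rw [if_pos hv, if_pos hu] at this
    split_ifs at this <;> omega)
  have b4 := step (fun a b c => a ∧ ¬ b ∧ ¬ c)
    (fun η => ¬ (openGraph η).Reachable o u₁ ∧ ¬ (openGraph η).Reachable o u₂ ∧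
      ((((A.erase v).erase u₁).erase u₂).filter fun b => η ∈ openConn o b).card = 0) (by
    rintro ω hω ⟨hp, -, -⟩ hN
    have hv : ω ∈ openConn o v := (RV ω hω).2 (Or.inl hp)
    have := BND ω hω
    rw [if_pos hv] at this
    refine ⟨fun h => ?_, fun h => ?_, ?_⟩
    · rw [if_pos (RU1 ω h)] at this; split_ifs at this <;> omega
    · rw [if_pos (RU2 ω h)] at this; split_ifs at this <;> omega
    · split_ifs at this <;> omega)
  have b5 := step (fun a b c => ¬ a ∧ b ∧ c)
    (fun η => ¬ (openGraph η).Reachable o u₁ ∧ ¬ (openGraph η).Reachable o u₂ ∧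
      ((((A.erase v).erase u₁).erase u₂).filter fun b => η ∈ openConn o b).card ≤ 1) (by
    rintro ω hω ⟨-, h1, h2⟩ hN
    have := BND ω hω
    refine ⟨fun h => ?_, fun h => ?_, ?_⟩
    · have hv : ω ∈ openConn o v := (RV ω hω).2 (Or.inr (Or.inl ⟨h1, h⟩))
      rw [if_pos hv, if_pos (RU1 ω h)] at this; split_ifs at this <;> omega
    · have hv : ω ∈ openConn o v := (RV ω hω).2 (Or.inr (Or.inr ⟨h2, h⟩))
      rw [if_pos hv, if_pos (RU2 ω h)] at this; split_ifs at this <;> omega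
    · split_ifs at this <;> omega)
  have b6 := step (fun a b c => ¬ a ∧ b ∧ ¬ c)
    (fun η => ¬ (openGraph η).Reachable o u₁ ∧
      ((openGraph η).Reachable o u₂ → ((((A.erase v).erase u₁).erase u₂).filter fun b => η ∈ openConn o b).card = 0) ∧
      ((((A.erase v).erase u₁).erase u₂).filter fun b => η ∈ openConn o b).card ≤ 1) (by
    rintro ω hω ⟨-, h1, -⟩ hN
    have := BND ω hω
    refine ⟨fun h => ?_, fun h => ?_, ?_⟩
    · have hv : ω ∈ openConn o v := (RV ω hω).2 (Or.inr (Or.inl ⟨h1, h⟩))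
      rw [if_pos hv, if_pos (RU1 ω h)] at this; split_ifs at this <;> omega
    · rw [if_pos (RU2 ω h)] at this; split_ifs at this <;> omega
    · split_ifs at this <;> omega)
  have b7 := step (fun a b c => ¬ a ∧ ¬ b ∧ c)
    (fun η => ¬ (openGraph η).Reachable o u₂ ∧
      ((openGraph η).Reachable o u₁ → ((((A.erase v).erase u₁).erase u₂).filter fun b => η ∈ openConn o b).card = 0) ∧
      ((((A.erase v).erase u₁).erase u₂).filter fun b => η ∈ openConn o b).card ≤ 1) (by
    rintro ω hω ⟨-, -, h2⟩ hN
    have := BND ω hω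
    refine ⟨fun h => ?_, fun h => ?_, ?_⟩
    · have hv : ω ∈ openConn o v := (RV ω hω).2 (Or.inr (Or.inr ⟨h2, h⟩))
      rw [if_pos hv, if_pos (RU2 ω h)] at this; split_ifs at this <;> omega
    · rw [if_pos (RU1 ω h)] at this; split_ifs at this <;> omega
    · split_ifs at this <;> omega)
  have b8 := step (fun a b c => ¬ a ∧ ¬ b ∧ ¬ c)
    (fun η => ¬ ((openGraph η).Reachable o u₁ ∧ (openGraph η).Reachable o u₂) ∧
      ((openGraph η).Reachable o u₁ → ((((A.erase v).erase u₁).erase u₂).filter fun b => η ∈ openConn o b).card = 0) ∧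
      ((openGraph η).Reachable o u₂ → ((((A.erase v).erase u₁).erase u₂).filter fun b => η ∈ openConn o b).card = 0) ∧
      ((((A.erase v).erase u₁).erase u₂).filter fun b => η ∈ openConn o b).card ≤ 1) (by
    rintro ω hω ⟨-, -, -⟩ hN
    have := BND ω hω
    refine ⟨fun h => ?_, fun h => ?_, fun h => ?_, ?_⟩
    · rw [if_pos (RU1 ω h.1), if_pos (RU2 ω h.2)] at this; split_ifs at this <;> omega
    · rw [if_pos (RU1 ω h)] at this; split_ifs at this <;> omega
    · rw [if_pos (RU2 ω h)] at this; split_ifs at this <;> omega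
    · split_ifs at this <;> omega)
  have h0 : (prodBernoulli w).real {_ω : BondConfig (Fin n) | False} = 0 := by
    have : {_ω : BondConfig (Fin n) | False} = (∅ : Set (BondConfig (Fin n))) := by ext ω; simp
    rw [this, measureReal_empty]
  rw [h0, mul_zero] at b1 b2 b3
  rw [real_state_occ (v := v) w ho1 ho2 h12] at b4
  rw [real_state_coo (v := v) w ho1 ho2 h12] at b5
  rw [real_state_coc (v := v) w ho1 ho2 h12] at b6
  rw [real_state_cco (v := v) w ho1 ho2 h12] at b7
  rw [real_state_ccc (v := v) w ho1 ho2 h12] at b8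
  rw [real_split₈ (prodBernoulli w) {ω : BondConfig (Fin n) | (A.filter fun a => ω ∈ openConn o a).card ≤ 1}
    s(o, v) s(v, u₁) s(v, u₂)]
  linarith [b1, b2, b3, b4, b5, b6, b7, b8]

end Law

end Gate3

end Quant

end Summit.CriticalPhenomena.PercolationContinuityZ3.Theorems
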